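import Literature.AlgebraicGeometry.ComplexMultiplication.SexticCMFieldPairFlip
import HarnessLib

/-!
# A sextic CM field with Galois closure of degree `48` realises EVERY signed permutation of its complex embeddings

COR-CM (cell `pub-hodgecm2`, binder seat `b16` gen 45, count-neutral claim REFLEX-OCTIC-34 part II, file T1); theorems
only, no definition, no named fact, no `sorry`.  Companion of `SexticCMFieldPairFlip` (degree `24`/`48` ⟹ pair flips):
for the GENERIC sextic CM field `K` (`[K^{gal} : ℚ] = 48 = |ℤ₂ ≀ 𝔖₃|`) the image of `Gal(K^{gal}/ℚ)` in the permutations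
of `Hom(K, ℂ)` is the full centraliser `W` of complex conjugation (Dodson's imprimitivity sequence
`0 → (ℤ₂)³ → G → 𝔖₃ → 1` with `v = 3`, `G₀ = 𝔖₃`), so EVERY permutation of `Hom(K, ℂ)` commuting with complex
conjugation is induced by an automorphism of `ℂ`:

* abstract (`exists_smul_eq_perm_of_card_eq`): a group of order `48` acting faithfully on six points with a central
  fixed-point-free involution `c` realises every permutation commuting with `c` (its image is all of
  `W = C_{𝔖₆}(cc)`, `|W| = 48`, tree `SexticB3.eq_W_of_card`);
* `exists_ringEquiv_smul_eq_perm_of_finrank_eq` — the number-field form;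
* `exists_ringEquiv_transposition_of_finrank_eq` — in particular a PURE TRANSPOSITION of two members of a CM type
  fixing the third (and acting compatibly on the conjugates) is realised — the element `t` of `ReflexTwinSlot`.

## References

* [Dodson1984] B. Dodson, *The structure of Galois groups of CM-fields*, Trans. AMS 283 (1984), §1 (Imprimitivity
  Theorem), §5.1.2.

Provenance: Literature home (namespace `Literature.AlgebraicGeometry.ComplexMultiplication.PairFlipSexticFullSignedPermutations`) of the Summits-side `CorCM/PairFlipSexticFullSignedPermutations` (cell `pub-hodgecm2`, COR-CM; all its imports are `Literature/`, Mathlib and the already re-homed `SexticCMFieldPairFlip`), which `Literature/` may not import; theorems only, no named fact, no definition. Nothing here bears on `HC_CM`. Lane `lit-hodgefound` (Layer A3: CM types, their Kubota ranks and Galois combinatorics), seat p20.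
-/

noncomputable section

open _root_.CategoryTheory NumberField Module
open scoped BigOperators Classical

namespace Literature.AlgebraicGeometry.ComplexMultiplication.PairFlipSexticFullSignedPermutations

open Literature.AlgebraicGeometry.ComplexMultiplication.GenericCMField

/-! ## §1 The abstract statement -/

section Abstract

open Equiv Literature.NumberTheory.ComplexMultiplication Literature.NumberTheory.ComplexMultiplication.SexticB3

variable {G : Type*} [Group G] {X : Type*} [Fintype X] [DecidableEq X] [MulAction G X] [FaithfulSMul G X]

/-- **A group of order `48` acting faithfully on six points with a central fixed-point-free involution `c` realises
every permutation commuting with `c`** (its permutation image is the whole centraliser `W`, `|W| = 48`).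
[cite: Dodson1984, §1 (Imprimitivity Theorem)] -/
theorem exists_smul_eq_perm_of_card_eq (hX : Fintype.card X = 6) (hcard : Nat.card G = 48) (c : G)
    (hcen : ∀ g : G, c * g = g * c) (hc2 : c * c = 1) (hfix : ∀ x : X, c • x ≠ x) (P : Perm X)
    (hP : ∀ x : X, P (c • x) = c • P x) : ∃ g : G, ∀ x : X, g • x = P x := by
  obtain ⟨x₀⟩ : Nonempty X := Fintype.card_pos_iff.1 (by rw [hX]; norm_num)
  obtain ⟨e, -, hce⟩ := exists_equiv_cc hX (MulAction.toPerm c)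
    (fun x => by simp [MulAction.toPerm_apply, smul_smul, hc2]) (fun x => hfix x) x₀
  replace hce : ∀ x, e (c • x) = cc (e x) := fun x => by simpa [MulAction.toPerm_apply] using hce x
  set f : G →* Perm (Fin 6) := toPerm6 e with hf
  have hfinj : Function.Injective f := toPerm6_injective e
  have hW : f.range ≤ W := range_toPerm6_le_W hcen hce
  have hcard' : Nat.card f.range = 48 := by
    rw [← Nat.card_congr (MonoidHom.ofInjective hfinj).toEquiv, hcard]
  have hrange : f.range = W := eq_W_of_card f.range hW hcard'
  -- transport `P` to `Fin 6`; it commutes with `cc`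
  set P6 : Perm (Fin 6) := (e.symm.trans P).trans e with hP6
  have hce' : ∀ i : Fin 6, e.symm (cc i) = c • e.symm i := fun i => by
    apply e.injective
    rw [Equiv.apply_symm_apply, hce, Equiv.apply_symm_apply]
  have hP6W : P6 ∈ W := by
    rw [mem_W]
    ext i
    simp only [Perm.coe_mul, Function.comp_apply, hP6, Equiv.trans_apply, hce', hP, hce]
  rw [← hrange] at hP6W
  obtain ⟨g, hg⟩ := hP6W
  refine ⟨g, fun x => ?_⟩
  have h1 := congrArg (fun p : Perm (Fin 6) => p (e x)) hg
  simp only [hf, toPerm6_apply, Equiv.symm_apply_apply, hP6, Equiv.trans_apply] at h1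
  exact e.injective h1

end Abstract

/-! ## §2 Sextic CM fields with Galois closure of degree `48` -/

open Literature.NumberTheory.ComplexMultiplication
open Literature.AlgebraicGeometry.Pohlmann1968

variable {K : Type} [Field K] [NumberField K] [IsCMField K]

/-- **Every permutation of `Hom(K, ℂ)` commuting with complex conjugation is induced by an automorphism of `ℂ`**, for a
sextic CM field `K` whose Galois closure `L` has degree `48`. [cite: Dodson1984, §1 (Imprimitivity Theorem) and §5.1.2] -/
theorem exists_ringEquiv_smul_eq_perm_of_finrank_eq (h6 : finrank ℚ K = 6) (L : Type) [Field L] [NumberField L]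
    [IsNormalClosure ℚ K L] (hL : finrank ℚ L = 48) (P : Equiv.Perm (K →+* ℂ))
    (hP : ∀ s : K →+* ℂ, P ((starRingAut : ℂ ≃+* ℂ) • s) = (starRingAut : ℂ ≃+* ℂ) • P s) :
    ∃ τ : ℂ ≃+* ℂ, ∀ s : K →+* ℂ, τ • s = P s := by
  classical
  haveI : IsCMField L := isCMField_of_isNormalClosure (K := K) (L := L)
  haveI : IsGalois ℚ L := isGalois_of_isNormalClosure (L := L) K
  have hX : Fintype.card (K →ₐ[ℚ] L) = 6 := by rw [card_algHom_eq_finrank K, h6]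
  have hcard : Nat.card (L ≃ₐ[ℚ] L) = 48 := by rw [IsGalois.card_aut_eq_finrank, hL]
  obtain ⟨j⟩ : Nonempty (K →ₐ[ℚ] L) := Fintype.card_pos_iff.1 (by rw [hX]; norm_num)
  obtain ⟨ι⟩ : Nonempty (L →+* ℂ) := inferInstance
  set e := algHomEquivRingHomOfNormal j ι with he
  have hec : ∀ χ : K →ₐ[ℚ] L, e ((conjGal : L ≃ₐ[ℚ] L) • χ) = (starRingAut : ℂ ≃+* ℂ) • e χ := fun χ => by
    rw [he, algHomEquivRingHomOfNormal_conjGal_smul, conj_smul_eq_conjugate]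
  have hec' : ∀ s : K →+* ℂ, e.symm ((starRingAut : ℂ ≃+* ℂ) • s) = (conjGal : L ≃ₐ[ℚ] L) • e.symm s := by
    intro s
    apply e.injective
    rw [Equiv.apply_symm_apply, hec, Equiv.apply_symm_apply]
  -- transport `P` to `Hom_ℚ(K, L)`
  set PX : Equiv.Perm (K →ₐ[ℚ] L) := (e.trans P).trans e.symm with hPX
  have hPXc : ∀ χ, PX ((conjGal : L ≃ₐ[ℚ] L) • χ) = (conjGal : L ≃ₐ[ℚ] L) • PX χ := fun χ => by
    simp only [hPX, Equiv.trans_apply, hec, hP, hec']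
  obtain ⟨g, hg⟩ := exists_smul_eq_perm_of_card_eq hX hcard (conjGal : L ≃ₐ[ℚ] L) conjGal_central
    conjGal_mul_conjGal conjGal_smul_ne PX hPXc
  obtain ⟨τ, hτ⟩ := exists_ringEquiv_forall_algHomEquivRingHomOfNormal_smul j ι g
  refine ⟨τ, fun s => ?_⟩
  have h1 := hτ (e.symm s)
  rw [← he, Equiv.apply_symm_apply, hg] at h1
  rw [← h1]
  simp only [hPX, Equiv.trans_apply, Equiv.apply_symm_apply]

/-- **A pure transposition of two members of a CM type, fixing the third**, is realised by an automorphism of `ℂ`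
(`[L : ℚ] = 48`; the hypotheses say that `x₁, x₂, x₃` and their conjugates are six distinct embeddings): the element
`t` of `ReflexTwinSlot`. [cite: Dodson1984, §5.1.2] -/
theorem exists_ringEquiv_transposition_of_finrank_eq (h6 : finrank ℚ K = 6) (L : Type) [Field L] [NumberField L]
    [IsNormalClosure ℚ K L] (hL : finrank ℚ L = 48) {x₁ x₂ x₃ : K →+* ℂ} (h13 : x₁ ≠ x₃) (h23 : x₂ ≠ x₃)
    (h11' : x₁ ≠ (starRingAut : ℂ ≃+* ℂ) • x₁) (h12' : x₁ ≠ (starRingAut : ℂ ≃+* ℂ) • x₂)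
    (h13' : x₃ ≠ (starRingAut : ℂ ≃+* ℂ) • x₁) (h22' : x₂ ≠ (starRingAut : ℂ ≃+* ℂ) • x₂)
    (h23' : x₃ ≠ (starRingAut : ℂ ≃+* ℂ) • x₂) :
    ∃ τ : ℂ ≃+* ℂ, τ • x₁ = x₂ ∧ τ • x₂ = x₁ ∧ τ • x₃ = x₃ := by
  classical
  have hcc : ∀ s : K →+* ℂ, (starRingAut : ℂ ≃+* ℂ) • (starRingAut : ℂ ≃+* ℂ) • s = s := fun s => by
    rw [conj_smul_eq_conjugate, conj_smul_eq_conjugate]; exact ComplexEmbedding.involutive_conjugate K s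
  set c : ℂ ≃+* ℂ := starRingAut with hc
  have h21' : x₂ ≠ c • x₁ := fun h => h12' (by rw [h, hcc])
  set P : Equiv.Perm (K →+* ℂ) := Equiv.swap x₁ x₂ * Equiv.swap (c • x₁) (c • x₂) with hPdef
  -- values of `P`
  have Px₁ : P x₁ = x₂ := by
    rw [hPdef, Equiv.Perm.mul_apply, Equiv.swap_apply_of_ne_of_ne h11' h12', Equiv.swap_apply_left]
  have Px₂ : P x₂ = x₁ := by
    rw [hPdef, Equiv.Perm.mul_apply, Equiv.swap_apply_of_ne_of_ne h21' h22', Equiv.swap_apply_right]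
  have Pc₁ : P (c • x₁) = c • x₂ := by
    rw [hPdef, Equiv.Perm.mul_apply, Equiv.swap_apply_left,
      Equiv.swap_apply_of_ne_of_ne (fun h => h12' h.symm) (fun h => h22' h.symm)]
  have Pc₂ : P (c • x₂) = c • x₁ := by
    rw [hPdef, Equiv.Perm.mul_apply, Equiv.swap_apply_right,
      Equiv.swap_apply_of_ne_of_ne (fun h => h11' h.symm) (fun h => h21' h.symm)]
  have Pfix : ∀ s : K →+* ℂ, s ≠ x₁ → s ≠ x₂ → s ≠ c • x₁ → s ≠ c • x₂ → P s = s := fun s h1 h2 h3 h4 => by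
    rw [hPdef, Equiv.Perm.mul_apply, Equiv.swap_apply_of_ne_of_ne h3 h4, Equiv.swap_apply_of_ne_of_ne h1 h2]
  -- `P` commutes with complex conjugation
  have hP : ∀ s : K →+* ℂ, P (c • s) = c • P s := by
    intro s
    by_cases h1 : s = x₁
    · rw [h1, Pc₁, Px₁]
    by_cases h2 : s = x₂
    · rw [h2, Pc₂, Px₂]
    by_cases h3 : s = c • x₁
    · rw [h3, hcc, Px₁, Pc₁, hcc]
    by_cases h4 : s = c • x₂
    · rw [h4, hcc, Px₂, Pc₂, hcc]
    rw [Pfix s h1 h2 h3 h4, Pfix (c • s) (fun h => h3 (by rw [← h, hcc])) (fun h => h4 (by rw [← h, hcc]))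
      (fun h => h1 (smul_left_cancel c h)) (fun h => h2 (smul_left_cancel c h))]
  obtain ⟨τ, hτ⟩ := exists_ringEquiv_smul_eq_perm_of_finrank_eq h6 L hL P hP
  refine ⟨τ, ?_, ?_, ?_⟩
  · rw [hτ, Px₁]
  · rw [hτ, Px₂]
  · rw [hτ, Pfix x₃ h13.symm h23.symm h13' h23']

end Literature.AlgebraicGeometry.ComplexMultiplication.PairFlipSexticFullSignedPermutations

end
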